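import Literature.Barriers.CriticalPhenomena.PlaquetteWalkHoleRootHoleColumnSeven
import Literature.Barriers.CriticalPhenomena.PlaquetteWalkHoleRootNoKissSeven
import HarnessLib

/-!
# Barrier catalogue (SAWScalingLimit): at the two hole-column cells NEXT TO THE HOLE there is NO wound class-`B2a` walk of limit cost `7` with a vertical end
(«HOLE COLUMN NEXT TO THE HOLE: NO VERTICAL-END LEVEL-`7` MEMBER»)

`Z → ∞` limit model of the printed Yang–Baxter weights [GlazmanManolescu2019, §1, eq. (1)]; the «RECTANGLE COEFFICIENT» line (b-engine-1 g29). Companion of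
`PlaquetteWalkHoleRootHoleColumnSeven` (a slanted-end member crosses `r` straight) and `PlaquetteWalkHoleRootHoleColumnAdjacent` (the slanted-end members at
`(w.1 − 1, w.2 ± 1)` are classified: three phases, no antipodal pair). The lane census (kit j298353: 449 + 448 cells next to the hole) finds NO cost-`7` class-`B2a`
member with a VERTICAL end (`E` or `W`) there; this file proves it:

* ★★★ `ΩG.not_cost_seven_vertical_holeColumn_adjacent_above` — no wound class-`B2a` walk of limit cost `7` from the hole root `w.side W` (hole `(w.1 − 1, w.2)` absent)
  ends on a VERTICAL side of `r = (w.1 − 1, w.2 + 1)`. SEVEN ISOLATED TURNS where a vertical end of cost `7` allows SIX (`cost = n_{u₁} + n_{u₂} + 1`): the arc of `r`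
  cannot use `S` (the plaquette below is the hole) nor the end side, so it TURNS through `N` and the other vertical side — `r` is an isolated turn and the walk reaches
  above `r`'s row, which is therefore not the top row: two top-row turns, two bottom-row turns, the root-row turn `τ` at the east end of the first turn's chain, `r`,
  and the end `e₁` of the horizontal chain of `r` (on `r`'s row, away from the end);
* ★★★ `ΩG.not_cost_seven_vertical_holeColumn_adjacent_below` / `…_adjacent` — the same at `(w.1 − 1, w.2 − 1)` by the row reflection [GlazmanManolescu2019, §4.2],
  and the two-sided statement `r.2 = w.2 + 1 ∨ r.2 = w.2 − 1`.

With `PlaquetteWalkHoleRootHoleColumnAdjacent` this settles the class-`B2a` part of the level-`7` wound sum at the cells next to the hole completely (slanted ends: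
phases `{7,2,4}` / `{2,7,5}`; vertical ends: none); the class-`B2b` extensions remain (census: the same phase sets).

[GlazmanManolescu2019 §1 Fig. 1, eq. (1), Lemma 2.1, Remark 2.2, §4.2; Glazman2015WeightedSAW Lemma 3.1 (proof, pp. 6–7); CourantRobbins1958 Ch. V App. §2]
-/

noncomputable section

namespace Literature.Probability.RandomPlanarGeometry.SAW.YangBaxter

open Real
open Literature.Barriers.CriticalPhenomena.PlaquetteWalk

open private fc_fh fh_add_Mv three_le_Mv from Literature.Probability.RandomPlanarGeometry.YangBaxterSAWGeneralDomain

namespace ΩG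

variable {D : Set Face} {w r : Face} {ω : ΩG D (w.side .W) r}

/-- ★★★ **NEXT TO THE HOLE, ABOVE: NO VERTICAL-END LEVEL-`7` MEMBER.** No wound class-`B2a` walk of limit cost `7` from the hole root `w.side W` (hole `(w.1 − 1, w.2)`
absent) ends on a vertical side (`E` or `W`) of the rhombus `r = (w.1 − 1, w.2 + 1)` just above the hole: seven isolated turns (two top, two bottom, the root-row turn,
`r` — whose arc turns through `N`, the plaquette below being the hole —, and the end of the horizontal chain of `r`) against the six that `cost = 7` allows a vertical
end. [cite: GlazmanManolescu2019, §1, Fig. 1 and eq. (1); Lemma 2.1; Remark 2.2] [cite: Glazman2015WeightedSAW, Lemma 3.1 (proof, pp. 6–7)]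
[cite: CourantRobbins1958, Ch. V Appendix §2 (the even–odd rule)] -/
theorem not_cost_seven_vertical_holeColumn_adjacent_above (hh : holeFaceW w ∉ D) (hr : RootedFace D (w.side .W) r) (h : ω.IsB2a)
    (hA : ω.AJ hr h (toC (midPt (w.side .W))) ≠ 0) (hc : cost (slotOfSide ω.1) ω.2.mids = 7) (hzv : ω.1 = .E ∨ ω.1 = .W)
    (hcol : r.1 = w.1 - 1) (hadj : r.2 = w.2 + 1) : False := by
  classical
  set n := ω.2.arcs.length with hn
  ---------------------------------------------------------------- basics
  have hF := ω.fh_lt h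
  have hlen : 0 < n := by omega
  have h0w : ω.2.fc 0 = w := fc_zero_eq_root w hh ω.2 hlen
  have h0W : ω.2.sIn 0 = .W := YBWalk.sIn_zero_eq_W hh ω.2 hlen
  have h0E : ω.2.sIn 0 ≠ .E := by rw [h0W]; decide
  have hfcF := (fc_fh ω hr h).1
  have hsvr : ∀ l < n, ω.2.fc l = ω.2.fc ω.2.firstHitG → l = ω.2.firstHitG := fun l hl e => eq_firstHitG_of_fc_eq hr h hl e
  have hfne3 : ω.2.firstHitG + 3 ≤ n := by have := three_le_Mv hr h; have := fh_add_Mv h; unfold ΩG.Mv at *; omega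
  have hn1 : n - 1 < n := by omega
  have hF1 : 1 ≤ ω.2.firstHitG := by
    by_contra h0
    have e : r = w := by rw [← hfcF, show ω.2.firstHitG = 0 by omega, h0w]
    have := congrArg Prod.fst e
    omega
  have hlast := last_of_vertical_end hr h hzv
  -- the end side of `r` is not used by the arc of `r`
  have hrside : ∀ s, ω.2.UsesSide r s → r.side s ≠ r.side ω.1 := by
    rintro s ⟨l, hl, hfl, hs⟩ e
    have hl' := hsvr l hl (hfl.trans hfcF.symm)
    obtain ⟨hin, hout⟩ := ω.2.side_sIn_eq_nth hl
    rw [hfl] at hin hout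
    rw [← ω.2.nth_length] at e
    rcases hs with hs | hs
    · rw [hs] at hin; have := ω.2.nth_inj (show l ≤ n by omega) le_rfl (hin.symm.trans e).symm.symm; omega
    · rw [hs] at hout; have := ω.2.nth_inj (show l + 1 ≤ n by omega) le_rfl (hout.symm.trans e).symm.symm; omega
  ---------------------------------------------------------------- the arc of `r`: not through `S` (the hole), not through the end side, hence a turn through `N`
  have hhole : holeFaceW w = (r.1, r.2 - 1) := by
    unfold holeFaceW; exact Prod.ext (by simp only; omega) (by simp only; omega)
  have hInS : ω.2.sIn ω.2.firstHitG ≠ .S := by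
    intro hS
    have hp := ω.2.fc_pred_eq_of_sIn_S hF hF1 hS
    rw [hfcF] at hp
    have hD : ω.2.fc (ω.2.firstHitG - 1) ∈ D := (YBWalk.arcFace_arcAt (show ω.2.firstHitG - 1 < n by omega)).2
    rw [hp] at hD
    exact hh (hhole ▸ hD)
  have hOutS : ω.2.sOut ω.2.firstHitG ≠ .S := by
    intro hS
    have hs := ω.2.fc_succ_eq_of_sOut_S (show ω.2.firstHitG + 1 < n by omega) hS
    rw [hfcF] at hs
    have hD : ω.2.fc (ω.2.firstHitG + 1) ∈ D := (YBWalk.arcFace_arcAt (show ω.2.firstHitG + 1 < n by omega)).2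
    rw [hs] at hD
    exact hh (hhole ▸ hD)
  have hInz : ω.2.sIn ω.2.firstHitG ≠ ω.1 := fun e => hrside _ ⟨_, hF, hfcF, Or.inl rfl⟩ (by rw [e])
  have hOutz : ω.2.sOut ω.2.firstHitG ≠ ω.1 := fun e => hrside _ ⟨_, hF, hfcF, Or.inr rfl⟩ (by rw [e])
  have hne := ω.2.sIn_ne_sOut hF
  have key : ∀ t : Side, ω.1 = t → ω.2.sIn ω.2.firstHitG ≠ t ∧ ω.2.sOut ω.2.firstHitG ≠ t :=
    fun t ht => ⟨fun e => hInz (e.trans ht.symm), fun e => hOutz (e.trans ht.symm)⟩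
  -- the arc of `r` uses `N`, turns, and its horizontal side is the one away from the end
  have hrNH : (ω.2.sIn ω.2.firstHitG = .N ∨ ω.2.sOut ω.2.firstHitG = .N) ∧
      arcKind (ω.2.sIn ω.2.firstHitG) (ω.2.sOut ω.2.firstHitG) ≠ .straight ∧
      ((ω.1 = .W ∧ (ω.2.sIn ω.2.firstHitG = .E ∨ ω.2.sOut ω.2.firstHitG = .E)) ∨
        (ω.1 = .E ∧ (ω.2.sIn ω.2.firstHitG = .W ∨ ω.2.sOut ω.2.firstHitG = .W))) := by
    rcases hzv with hz | hz
    · obtain ⟨h1, h2⟩ := key _ hz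
      have hzW : ω.1 ≠ .W := by rw [hz]; decide
      have : (ω.2.sIn ω.2.firstHitG = .N ∨ ω.2.sOut ω.2.firstHitG = .N) ∧
          arcKind (ω.2.sIn ω.2.firstHitG) (ω.2.sOut ω.2.firstHitG) ≠ .straight ∧
          (ω.2.sIn ω.2.firstHitG = .W ∨ ω.2.sOut ω.2.firstHitG = .W) := by
        revert hne hInS hOutS h1 h2; cases ω.2.sIn ω.2.firstHitG <;> cases ω.2.sOut ω.2.firstHitG <;> decide
      exact ⟨this.1, this.2.1, Or.inr ⟨hz, this.2.2⟩⟩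
    · obtain ⟨h1, h2⟩ := key _ hz
      have : (ω.2.sIn ω.2.firstHitG = .N ∨ ω.2.sOut ω.2.firstHitG = .N) ∧
          arcKind (ω.2.sIn ω.2.firstHitG) (ω.2.sOut ω.2.firstHitG) ≠ .straight ∧
          (ω.2.sIn ω.2.firstHitG = .E ∨ ω.2.sOut ω.2.firstHitG = .E) := by
        revert hne hInS hOutS h1 h2; cases ω.2.sIn ω.2.firstHitG <;> cases ω.2.sOut ω.2.firstHitG <;> decide
      exact ⟨this.1, this.2.1, Or.inl ⟨hz, this.2.2⟩⟩
  obtain ⟨hrN, hNS, hrH0⟩ := hrNH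
  have hrH : (ω.1 = .W ∧ ω.2.UsesSide r .E) ∨ (ω.1 = .E ∧ ω.2.UsesSide r .W) := by
    rcases hrH0 with ⟨hz, hs⟩ | ⟨hz, hs⟩
    · exact Or.inl ⟨hz, _, hF, hfcF, hs⟩
    · exact Or.inr ⟨hz, _, hF, hfcF, hs⟩
  ---------------------------------------------------------------- isolated turns: six, as `P`-cells
  have h6 : cfgCount ω.2.mids [.corner] + cfgCount ω.2.mids [.coCorner] = 6 := by
    have hcost : cost (slotOfSide ω.1) ω.2.mids =
        cfgCount ω.2.mids [.corner] + cfgCount ω.2.mids [.coCorner] + (1 - slotDeg (slotOfSide ω.1)) := rfl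
    have hd : slotDeg (slotOfSide ω.1) = 0 := by rcases hzv with e | e <;> rw [e] <;> rfl
    rw [hcost, hd] at hc; omega
  let P : Face → Prop := fun f => f ∈ facesL ω.2.mids ∧ (kindsL ω.2.mids f = [.corner] ∨ kindsL ω.2.mids f = [.coCorner])
  have hPiso : ∀ k < n, (∀ l < n, ω.2.fc l = ω.2.fc k → l = k) → arcKind (ω.2.sIn k) (ω.2.sOut k) ≠ .straight → P (ω.2.fc k) :=
    fun k hk hsv hkind => isolated_turn hk hsv hkind
  have hle6 : ∀ T : Finset Face, (∀ f ∈ T, P f) → T.card ≤ 6 := by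
    intro T hT; have := YBWalk.card_le_cfgCount_add ω.2.mids T hT; omega
  have hPr : P r := by have := hPiso _ hF hsvr hNS; rwa [hfcF] at this
  -- an arc above the row of `r`: the neighbour of `r` across `N`
  have hup : ∃ j < n, (ω.2.fc j).2 = r.2 + 1 := by
    rcases hrN with hN | hN
    · exact ⟨ω.2.firstHitG - 1, by omega, by rw [ω.2.fc_pred_eq_of_sIn_N hF hF1 hN, hfcF]⟩
    · exact ⟨ω.2.firstHitG + 1, by omega, by rw [ω.2.fc_succ_eq_of_sOut_N (show ω.2.firstHitG + 1 < n by omega) hN, hfcF]⟩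
  -- top and bottom turns
  obtain ⟨Y, hYw, hY, Tt, hTtP, hTtrow, hTtcard⟩ := two_top_turns hh hr h hA
  have hrY : r.2 < Y := by obtain ⟨j, hj, hjr⟩ := hup; have := hY j hj; omega
  have hTt2 : 1 < Tt.card := by
    rcases hTtcard with h2 | ⟨-, -, hrY'⟩
    · omega
    · exfalso; omega
  obtain ⟨t₁, ht₁, t₂, ht₂, ht12⟩ := Finset.one_lt_card.1 hTt2
  have hPt₁ : P t₁ := hTtP t₁ ht₁
  have hPt₂ : P t₂ := hTtP t₂ ht₂
  have ht₁row : t₁.2 = Y := hTtrow t₁ ht₁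
  have ht₂row : t₂.2 = Y := hTtrow t₂ ht₂
  obtain ⟨Y', hY'w, hY', Tb, hTbP, hTbrow, hTbcard⟩ := two_bottom_turns hh hr h hA
  have hTb2 : 1 < Tb.card := by
    rcases hTbcard with h2 | ⟨-, -, hrY'⟩
    · omega
    · exfalso; omega
  obtain ⟨b₁, hb₁, b₂, hb₂, hb12⟩ := Finset.one_lt_card.1 hTb2
  have hPb₁ : P b₁ := hTbP b₁ hb₁
  have hPb₂ : P b₂ := hTbP b₂ hb₂
  have hb₁row : b₁.2 = Y' := hTbrow b₁ hb₁
  have hb₂row : b₂.2 = Y' := hTbrow b₂ hb₂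
  obtain ⟨X', -, hX', -⟩ := exists_right_entry_turn hh hr h
  obtain ⟨X, hXw, hX, -⟩ := exists_left_entry_turn hh hr h hA
  ---------------------------------------------------------------- the first turn and the root-row turn `τ = (τ1, w.2)`, `τ1 ≥ w.1`
  have hexk : ∃ k, k < n ∧ arcKind (ω.2.sIn k) (ω.2.sOut k) ≠ .straight := ⟨_, hF, hNS⟩
  obtain ⟨hk₁, -⟩ := Nat.find_spec hexk
  set k₁ := Nat.find hexk with hk₁def
  have hstr : ∀ i < k₁, arcKind (ω.2.sIn i) (ω.2.sOut i) = .straight := by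
    intro i hi; by_contra hne'; exact Nat.find_min hexk hi ⟨by omega, hne'⟩
  obtain ⟨hrun, -⟩ := ω.2.initial_run hh hk₁ hstr
  obtain ⟨hfk, hWk⟩ := hrun k₁ le_rfl
  have hp₁W : ω.2.UsesSide (w.1 + k₁, w.2) .W := ⟨k₁, hk₁, hfk, Or.inl hWk⟩
  -- the last plaquette lies on the row of `r`, not on the root row
  have hLrow : (ω.2.fc (n - 1)).2 = r.2 := by
    rcases hlast with ⟨-, -, hL⟩ | ⟨-, -, hL⟩ <;> rw [hL]
  obtain ⟨τ1, hPτ, hτ1w⟩ : ∃ τ1 : ℤ, P (τ1, w.2) ∧ w.1 + k₁ ≤ τ1 := by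
    by_cases hpE : ω.2.UsesSide (w.1 + k₁, w.2) .E
    · obtain ⟨M, hWall, -, hend⟩ := ω.2.chain_E hX' hpE
      rcases hend with ⟨hM1, hnot⟩ | ⟨-, hs0⟩ | ⟨heZ, -⟩
      · obtain ⟨i', hi', hfc', hsv', -, -, -, hk'⟩ := ω.2.isolated_of_usesSide_not_opp (hWall M hM1 le_rfl) hnot
        refine ⟨w.1 + k₁ + M, ?_, by omega⟩
        have := hPiso i' hi' hsv' hk'; rw [hfc'] at this; exact this
      · exact absurd hs0 h0E
      · exfalso; have := congrArg Prod.snd heZ; rw [hLrow] at this; simp only at this; omega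
    · obtain ⟨i', hi', hfc', hsv', -, -, -, hk'⟩ := ω.2.isolated_of_usesSide_not_opp hp₁W hpE
      refine ⟨w.1 + k₁, ?_, le_rfl⟩
      have := hPiso i' hi' hsv' hk'; rw [hfc'] at this; exact this
  ---------------------------------------------------------------- one more isolated turn strictly between the extreme rows, off the root row and distinct from `r`, is too many
  have hne_of_row : ∀ f g : Face, f.2 ≠ g.2 → f ≠ g := fun f g hfg e => hfg (by rw [e])
  have houts1 : ∀ g : Face, P g → Y' < g.2 → g.2 < Y → g.2 ≠ w.2 → g ≠ r → False := by
    intro g hP₁ a1 a2 a3 a4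
    have n1 : g ≠ t₁ := hne_of_row _ _ (by rw [ht₁row]; omega)
    have n2 : g ≠ t₂ := hne_of_row _ _ (by rw [ht₂row]; omega)
    have n3 : g ≠ b₁ := hne_of_row _ _ (by rw [hb₁row]; omega)
    have n4 : g ≠ b₂ := hne_of_row _ _ (by rw [hb₂row]; omega)
    have n5 : g ≠ ((τ1 : ℤ), w.2) := hne_of_row _ _ (by simp only; exact a3)
    have h01 : t₁ ≠ t₂ := ht12
    have h02 : t₁ ≠ b₁ := hne_of_row _ _ (by rw [ht₁row, hb₁row]; omega)
    have h03 : t₁ ≠ b₂ := hne_of_row _ _ (by rw [ht₁row, hb₂row]; omega)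
    have h04 : t₁ ≠ ((τ1 : ℤ), w.2) := hne_of_row _ _ (by rw [ht₁row]; simp only; omega)
    have h05 : t₁ ≠ r := hne_of_row _ _ (by rw [ht₁row]; omega)
    have h15 : t₂ ≠ r := hne_of_row _ _ (by rw [ht₂row]; omega)
    have h12 : t₂ ≠ b₁ := hne_of_row _ _ (by rw [ht₂row, hb₁row]; omega)
    have h13 : t₂ ≠ b₂ := hne_of_row _ _ (by rw [ht₂row, hb₂row]; omega)
    have h14 : t₂ ≠ ((τ1 : ℤ), w.2) := hne_of_row _ _ (by rw [ht₂row]; simp only; omega)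
    have h23 : b₁ ≠ b₂ := hb12
    have h24 : b₁ ≠ ((τ1 : ℤ), w.2) := hne_of_row _ _ (by rw [hb₁row]; simp only; omega)
    have h25 : b₁ ≠ r := hne_of_row _ _ (by rw [hb₁row]; omega)
    have h34 : b₂ ≠ ((τ1 : ℤ), w.2) := hne_of_row _ _ (by rw [hb₂row]; simp only; omega)
    have h35 : b₂ ≠ r := hne_of_row _ _ (by rw [hb₂row]; omega)
    have h45 : ((τ1 : ℤ), w.2) ≠ r := hne_of_row _ _ (by simp only; omega)
    have hT : ∀ f ∈ ({g, t₁, t₂, b₁, b₂, ((τ1 : ℤ), w.2), r} : Finset Face), P f := by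
      intro f hf
      simp only [Finset.mem_insert, Finset.mem_singleton] at hf
      rcases hf with rfl | rfl | rfl | rfl | rfl | rfl | rfl
      exacts [hP₁, hPt₁, hPt₂, hPb₁, hPb₂, hPτ, hPr]
    have hcard : ({g, t₁, t₂, b₁, b₂, ((τ1 : ℤ), w.2), r} : Finset Face).card = 7 := by
      rw [Finset.card_insert_of_notMem (by simp only [Finset.mem_insert, Finset.mem_singleton, not_or]; exact ⟨n1, n2, n3, n4, n5, a4⟩),
        Finset.card_insert_of_notMem (by simp only [Finset.mem_insert, Finset.mem_singleton, not_or]; exact ⟨h01, h02, h03, h04, h05⟩),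
        Finset.card_insert_of_notMem (by simp only [Finset.mem_insert, Finset.mem_singleton, not_or]; exact ⟨h12, h13, h14, h15⟩),
        Finset.card_insert_of_notMem (by simp only [Finset.mem_insert, Finset.mem_singleton, not_or]; exact ⟨h23, h24, h25⟩),
        Finset.card_insert_of_notMem (by simp only [Finset.mem_insert, Finset.mem_singleton, not_or]; exact ⟨h34, h35⟩),
        Finset.card_insert_of_notMem (by simp only [Finset.mem_singleton]; exact h45), Finset.card_singleton]
    have := hle6 _ hT
    omega
  ---------------------------------------------------------------- the horizontal chain of `r` ends at a seventh isolated turn `e₁` on the row of `r`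
  obtain ⟨e₁, hPe₁, he₁row, he₁ne⟩ : ∃ e₁ : Face, P e₁ ∧ e₁.2 = r.2 ∧ e₁ ≠ r := by
    rcases hrH with ⟨hzW, hrE⟩ | ⟨hzE, hrW⟩
    · obtain ⟨M, hWall, -, hend⟩ := ω.2.chain_E hX' hrE
      rcases hend with ⟨hM1, hnot⟩ | ⟨he0, -⟩ | ⟨heZ, -⟩
      · obtain ⟨i', hi', hfc', hsv', -, -, -, hk'⟩ := ω.2.isolated_of_usesSide_not_opp (hWall M hM1 le_rfl) hnot
        refine ⟨(r.1 + M, r.2), ?_, rfl, by intro e; have := congrArg Prod.fst e; simp only at this; omega⟩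
        have := hPiso i' hi' hsv' hk'; rw [hfc'] at this; exact this
      · exfalso; rw [h0w] at he0; have := congrArg Prod.snd he0; simp only at this; omega
      · exfalso
        rcases hlast with ⟨hzE', -, -⟩ | ⟨-, -, hL⟩
        · rw [hzW] at hzE'; exact absurd hzE' (by decide)
        · rw [hL] at heZ; have := congrArg Prod.fst heZ; simp only at this; omega
    · obtain ⟨M, hEall, -, hend⟩ := ω.2.chain_W hX hrW
      rcases hend with ⟨hM1, hnot⟩ | ⟨he0, -⟩ | ⟨heZ, -⟩
      · obtain ⟨i', hi', hfc', hsv', -, -, -, hk'⟩ := ω.2.isolated_of_usesSide_not_opp (hEall M hM1 le_rfl) hnot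
        refine ⟨(r.1 - M, r.2), ?_, rfl, by intro e; have := congrArg Prod.fst e; simp only at this; omega⟩
        have := hPiso i' hi' hsv' hk'; rw [hfc'] at this; exact this
      · exfalso; rw [h0w] at he0; have := congrArg Prod.snd he0; simp only at this; omega
      · exfalso
        rcases hlast with ⟨-, -, hL⟩ | ⟨hzW', -, -⟩
        · rw [hL] at heZ; have := congrArg Prod.fst heZ; simp only at this; omega
        · rw [hzE] at hzW'; exact absurd hzW' (by decide)
  exact houts1 e₁ hPe₁ (by omega) (by omega) (by omega) he₁ne

/-- ★★★ **NEXT TO THE HOLE, BELOW: NO VERTICAL-END LEVEL-`7` MEMBER** — the row reflection [GlazmanManolescu2019, §4.2] of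
`not_cost_seven_vertical_holeColumn_adjacent_above` (vertical ends, the cost and the hole root are preserved by `ω.mirrorAt`).
[cite: GlazmanManolescu2019, §1, Fig. 1 and eq. (1); Lemma 2.1; Remark 2.2; §4.2 (lattice symmetries)] [cite: Glazman2015WeightedSAW, Lemma 3.1 (proof, pp. 6–7)] -/
theorem not_cost_seven_vertical_holeColumn_adjacent_below (hh : holeFaceW w ∉ D) (hr : RootedFace D (w.side .W) r) (h : ω.IsB2a)
    (hA : ω.AJ hr h (toC (midPt (w.side .W))) ≠ 0) (hc : cost (slotOfSide ω.1) ω.2.mids = 7) (hzv : ω.1 = .E ∨ ω.1 = .W)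
    (hcol : r.1 = w.1 - 1) (hadj : r.2 = w.2 - 1) : False := by
  have hh' : holeFaceW w ∉ rowMirrorDom w D := by
    rw [mem_rowMirrorDom]
    have e : mirrorRowFace w.2 (holeFaceW w) = holeFaceW w := by
      simp only [mirrorRowFace, holeFaceW]; exact Prod.ext rfl (by simp only; ring)
    rw [e]; exact hh
  have hr' := rootedFace_rowMirrorDom_mirrorRowFace (w := w) hr
  have h' := isB2a_mirrorAt hr h
  have hA' := AJ_mirrorAt_ne_zero hr h hA
  have hc' : cost (slotOfSide ω.mirrorAt.1) ω.mirrorAt.2.mids = 7 := by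
    show cost (slotOfSide (mirrorSide ω.1)) (ω.2.mids.map (mirrorRow w.2)) = 7
    rw [cost_map_mirrorRow]; exact hc
  have hzv' : ω.mirrorAt.1 = .E ∨ ω.mirrorAt.1 = .W := by
    show mirrorSide ω.1 = .E ∨ mirrorSide ω.1 = .W
    rcases hzv with e | e <;> rw [e]
    · exact Or.inl rfl
    · exact Or.inr rfl
  have hcol' : (mirrorRowFace w.2 r).1 = w.1 - 1 := by simp only [mirrorRowFace]; exact hcol
  have hadj' : (mirrorRowFace w.2 r).2 = w.2 + 1 := by simp only [mirrorRowFace]; omega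
  exact not_cost_seven_vertical_holeColumn_adjacent_above (ω := ω.mirrorAt) hh' hr' h' hA' hc' hzv' hcol' hadj'

/-- ★★★ **NEXT TO THE HOLE: NO VERTICAL-END LEVEL-`7` CLASS-`B2a` MEMBER** (both cells `(w.1 − 1, w.2 ± 1)`).
[cite: GlazmanManolescu2019, §1, Fig. 1 and eq. (1); Lemma 2.1; Remark 2.2; §4.2] [cite: Glazman2015WeightedSAW, Lemma 3.1 (proof, pp. 6–7)] -/
theorem not_cost_seven_vertical_holeColumn_adjacent (hh : holeFaceW w ∉ D) (hr : RootedFace D (w.side .W) r) (h : ω.IsB2a)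
    (hA : ω.AJ hr h (toC (midPt (w.side .W))) ≠ 0) (hc : cost (slotOfSide ω.1) ω.2.mids = 7) (hzv : ω.1 = .E ∨ ω.1 = .W)
    (hcol : r.1 = w.1 - 1) (hadj : r.2 = w.2 + 1 ∨ r.2 = w.2 - 1) : False := by
  rcases hadj with e | e
  · exact not_cost_seven_vertical_holeColumn_adjacent_above hh hr h hA hc hzv hcol e
  · exact not_cost_seven_vertical_holeColumn_adjacent_below hh hr h hA hc hzv hcol e

end ΩG

end Literature.Probability.RandomPlanarGeometry.SAW.YangBaxter
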